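import Summits.CriticalPhenomena.Ising3DConformalLimit.Theses.ArmHyperscaling
import Summits.CriticalPhenomena.Ising3DConformalLimit.Theorems.HyperoctahedralRPHRP2Rigidity
import Summits.CriticalPhenomena.Ising3DConformalLimit.Theorems.HyperoctahedralRPLimitRotationInvariant
import HarnessLib

/-!
# Crux `ArmHyperscaling.IsotropyFromOneArm` (stmt-CriticalPhenomena-15593) — line `landed-composition`
# (crux-plan seat `planner-cruxplan-stmt-CriticalPhenomena-15593-landed-composition-0`, 2026-08-17)

**Skeleton with ZERO stubs: the composition below is the complete, sorry-free proof of the crux.**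
(Merge-twin of line `landed-isotropy` — `Lines/landed_isotropy.lean`, same proof term; the triage panel r1-1 / r1-2
graded both ideas `pass` and recorded `merge: landed-composition ≈ landed-isotropy`.  A lead may pick either file; they are
interchangeable.  LAND VERBATIM as
`Summits/CriticalPhenomena/Ising3DConformalLimit/Theorems/ArmHyperscalingIsotropyFromOneArm.lean --workitem stmt-CriticalPhenomena-15593`.)

The crux reads `OneArmHyperscaling → C` with
`C := ∀ ρ Δ S, (ρ > 0 on (0,1]) → HasPointwiseScalingLimit (criticalCorr 3) ρ S → (S = 0 off NonCoincident) →
IsNondegenerateTwoPoint S → IsTranslationInvariant S → IsScaleCovariant Δ S → IsRotationInvariant S`.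
`C` is, token for token, the consequent of the route decl `HyperoctahedralRP.LimitRotationInvariant := HRP2Rigidity → C`
(crux stmt-CriticalPhenomena-1980), and both PIECES are landed theorems of the tree:

* piece 1 — `HyperoctahedralRP.HRP2Rigidity` (stmt-CriticalPhenomena-1979, closed `proved`):
  `Cruxes.HRP2Rigidity.XRayMellin.HRP2Rigidity_of` (`Theorems/HyperoctahedralRPHRP2Rigidity.lean`);
* piece 2 — `HyperoctahedralRP.LimitRotationInvariant` (stmt-CriticalPhenomena-1980, closed `proved`):
  `Cruxes.LimitRotationInvariant.QuarterTurnLiouville.limitRotationInvariant_proof`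
  (`Theorems/HyperoctahedralRPLimitRotationInvariant.lean`, through crux stmt-8367 `rotationUpgradeFromTwoPoint_proof`).

Composition: `IsotropyFromOneArm_of : IsotropyFromOneArm := fun _ => limitRotationInvariant_proof HRP2Rigidity_of` (closed, by name;
the one-arm antecedent is NOT consumed); the skeleton shape over the pieces is recorded as
`IsotropyFromOneArm_of_pieces : HRP2Rigidity → LimitRotationInvariant → IsotropyFromOneArm := fun h₁ h₂ _ => h₂ h₁`.
No `stub_*`: nothing is left to prove; re-sorrying either piece would be costume.  Disproof.lean: none exists for this crux
(2026-08-17), and no `_false_without_<H>` can hold — the proof uses no hypothesis `H` of the crux at all.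
-/

noncomputable section

namespace Summit.CriticalPhenomena.Ising3DConformalLimit.Cruxes.IsotropyFromOneArm.LandedComposition

/-- **`IsotropyFromOneArm_of`** — crux `ArmHyperscaling.IsotropyFromOneArm` (item stmt-CriticalPhenomena-15593) BY NAME,
sorry-free, ZERO stubs: the landed theorem `limitRotationInvariant_proof` (crux stmt-1980) applied to the landed theorem
`HRP2Rigidity_of` (crux stmt-1979); the one-arm hypothesis `_hOA` is discarded. -/
theorem IsotropyFromOneArm_of :
    _root_.Summit.CriticalPhenomena.Ising3DConformalLimit.Theses.ArmHyperscaling.IsotropyFromOneArm :=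
  fun _hOA =>
    _root_.Summit.CriticalPhenomena.Ising3DConformalLimit.Cruxes.LimitRotationInvariant.QuarterTurnLiouville.limitRotationInvariant_proof
      _root_.Summit.CriticalPhenomena.Ising3DConformalLimit.Cruxes.HRP2Rigidity.XRayMellin.HRP2Rigidity_of

/-- Same theorem under the `<decl>_proof` naming used by the closing files of cruxes 1979 / 1980 / 8367 (the name a lead
prover lands in `Theorems/ArmHyperscalingIsotropyFromOneArm.lean`). -/
theorem isotropyFromOneArm_proof :
    _root_.Summit.CriticalPhenomena.Ising3DConformalLimit.Theses.ArmHyperscaling.IsotropyFromOneArm :=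
  IsotropyFromOneArm_of

/-- **The composition over the two pieces** (the skeleton shape `piece₁ → piece₂ → crux`, both pieces LANDED route decls of
`HyperoctahedralRP`): `HRP2Rigidity → LimitRotationInvariant → IsotropyFromOneArm` is modus ponens
(`LimitRotationInvariant` unfolds to `HRP2Rigidity → C`, `IsotropyFromOneArm` to `OneArmHyperscaling → C`). -/
theorem IsotropyFromOneArm_of_pieces :
    _root_.Summit.CriticalPhenomena.Ising3DConformalLimit.Theses.HyperoctahedralRP.HRP2Rigidity →
    _root_.Summit.CriticalPhenomena.Ising3DConformalLimit.Theses.HyperoctahedralRP.LimitRotationInvariant →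
    _root_.Summit.CriticalPhenomena.Ising3DConformalLimit.Theses.ArmHyperscaling.IsotropyFromOneArm :=
  fun h1979 h1980 _hOA => h1980 h1979

/-- The pieces-composition fed with the two landed theorems is (definitionally) the proof above. -/
example : _root_.Summit.CriticalPhenomena.Ising3DConformalLimit.Theses.ArmHyperscaling.IsotropyFromOneArm :=
  IsotropyFromOneArm_of_pieces
    _root_.Summit.CriticalPhenomena.Ising3DConformalLimit.Cruxes.HRP2Rigidity.XRayMellin.HRP2Rigidity_of
    _root_.Summit.CriticalPhenomena.Ising3DConformalLimit.Cruxes.LimitRotationInvariant.QuarterTurnLiouville.limitRotationInvariant_proof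

/-- Mechanical cross-check of the "token for token" claim (the Transfer C⁺ → crux): the crux is definitionally the
weakening of `HyperoctahedralRP.LimitRotationInvariant`'s consequent by the one-arm antecedent. -/
example :
    _root_.Summit.CriticalPhenomena.Ising3DConformalLimit.Theses.HyperoctahedralRP.LimitRotationInvariant →
    _root_.Summit.CriticalPhenomena.Ising3DConformalLimit.Theses.ArmHyperscaling.IsotropyFromOneArm :=
  fun h _ => h _root_.Summit.CriticalPhenomena.Ising3DConformalLimit.Cruxes.HRP2Rigidity.XRayMellin.HRP2Rigidity_of

end Summit.CriticalPhenomena.Ising3DConformalLimit.Cruxes.IsotropyFromOneArm.LandedComposition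

end
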